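import Summits.CriticalPhenomena.PercolationContinuityZ3.Theorems.PercNearOneGluingNoHeavyLowerTailQ7PsiSetObserverGreen
import Summits.CriticalPhenomena.PercolationContinuityZ3.Theorems.PercNearOneGluingNoHeavyLowerTailQ7PsiSetObserverGpsi
import Summits.CriticalPhenomena.PercolationContinuityZ3.Theorems.PercNearOneGluingNoHeavyLowerTailQ7ThreeOfCovTau
import HarnessLib

/-!
# `NoHeavyLowerTail` (stmt-CriticalPhenomena-4575) — the pre-FKG inequality (41) for a SET of observers at `|A| = 3`
# (Kozma–Nitzan Question 9 at three relays) from (GΨ₃-set), hence from the set-observer marker dominance lemma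

Support file (`--supports stmt-CriticalPhenomena-4575`), coupling seat `prim-cplus-coupling` (gen 13).  No
definitions, no named facts, no sorries.  Memo A5-COUPLING-gen13.md §1, §5 (blueprint step B7).

For an observer SET `N` write `N ↔ v := ∃ n ∈ N, n ↔ v`.  Kozma–Nitzan's Question 9 (arXiv:2401.12397 p. 36) is, after
conditioning on the open pairs at the observer, the inequality
`(41)_N:  P(z ↔ b, N ↔ A) ≤ P(N ↔ b, N ↔ A)` for the relay `z ∈ A` least connected to `b` (memo §1; prim-lf-3's "anchored
q7_three" is `(41)_N` with `N` = the glued atom).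
* `Q7Psi.setPreFKG_three_of_gpsiSet` — `(41)_N` at `A = {x, y, z}` (`z` the designated least-reliable relay, reliabilities
  measured in `G` itself) FROM (GΨ₃-set) on `G ∖ b` for the green function (tools: `…Q7PsiSetObserverGreen`);
* `Q7Psi.setPreFKG_three_of_setMDL` — the same from the set-observer marker dominance lemma on `G ∖ b`
  (`Q7Psi.gpsi_three_set_of_setMDL`), i.e. KN Question 9 at `|A| = 3` modulo the one atom of memo §3.3 (and the
  non-degeneracy `μ(x↮y,x↮z), μ(y↮x,y↮z) > 0` off `b`).  For `N = {o}` these are `Q7Psi.q7_three_of_covTau` / `q7_three`.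
[cite: KozmaNitzan2024, Question 9 (p. 36), Lemma 5 (p. 13), §5.1 (pp. 31–32)] [cite: Grimmett1999, §2.2 (product measure)]
-/

namespace Summit.CriticalPhenomena.PercolationContinuityZ3.Theorems

open MeasureTheory Set Literature.Probability.LatticeModels Literature.Probability.Percolation
open scoped Classical
open KNPreFKG

noncomputable section

namespace Q7Psi

variable {V : Type*} [Fintype V]

/-- **`(41)_N` at three relays from (GΨ₃-set) on `G ∖ b`.**  Let `N` be an observer set with `b ∉ N`, `x, y, z ≠ b` distinct
relays with `μ(z↔b) ≤ μ(x↔b)`, `μ(z↔b) ≤ μ(y↔b)` (reliabilities in `G` itself).  IF (GΨ₃-set) holds on the graph `G ∖ b`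
(vertex type `↥{b}ᶜ`, induced weights) for the relays `x, y, z`, the observer set `N` and every monotone real function of
vertex sets, THEN `μ({z↔b} ∩ {N↔A}) ≤ μ({N↔b} ∩ {N↔A})`, `A = {x,y,z}`, `{N↔v} = {∃ n ∈ N, n↔v}`.
Proof: `set_q7_of_psi`; the `z`-part `{N↔z in G∖b} ∖ ({N↔x in G∖b} ∪ {N↔y in G∖b})` only helps (`z↔b ⟹ N↔b` there); on
`{N↔x in G∖b} ∪ {N↔y in G∖b}` the two green bridges (`real_inter_openConn_eq_integral_green` for `z`,
`real_inter_setReach_eq_integral_green` for `N`) turn both sides into integrals over `G ∖ b` of the monotone green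
function at `C_{G∖b}(z)` resp. `C_{G∖b}(N) = ⋃_n C_{G∖b}(n)`, and the reliabilities into its means.
[cite: KozmaNitzan2024, Question 9 (p. 36), Lemma 5 (p. 13), §5.1 (pp. 31–32)] -/
theorem setPreFKG_three_of_gpsiSet (w : Sym2 V → unitInterval) (N : Set V) (b x y z : V) (hbN : b ∉ N)
    (hxb : x ≠ b) (hyb : y ≠ b) (hzb : z ≠ b)
    (hG : ∀ F : Set ({b}ᶜ : Set V) → ℝ, (∀ T T' : Set ({b}ᶜ : Set V), T ⊆ T' → F T ≤ F T') →
      (∫ ω', F (openCluster ω' ⟨z, mem_compl_singleton_iff.2 hzb⟩) ∂(prodBernoulli (w ∘ Sym2.map (Subtype.val : ({b}ᶜ : Set V) → V))) ≤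
        ∫ ω', F (openCluster ω' ⟨x, mem_compl_singleton_iff.2 hxb⟩) ∂(prodBernoulli (w ∘ Sym2.map (Subtype.val : ({b}ᶜ : Set V) → V)))) →
      (∫ ω', F (openCluster ω' ⟨z, mem_compl_singleton_iff.2 hzb⟩) ∂(prodBernoulli (w ∘ Sym2.map (Subtype.val : ({b}ᶜ : Set V) → V))) ≤
        ∫ ω', F (openCluster ω' ⟨y, mem_compl_singleton_iff.2 hyb⟩) ∂(prodBernoulli (w ∘ Sym2.map (Subtype.val : ({b}ᶜ : Set V) → V)))) →
      ∫ ω' in {ω' : BondConfig ({b}ᶜ : Set V) | ∃ n ∈ (Subtype.val : ({b}ᶜ : Set V) → V) ⁻¹' N,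
            (openGraph ω').Reachable ⟨x, mem_compl_singleton_iff.2 hxb⟩ n} ∪
          {ω' | ∃ n ∈ (Subtype.val : ({b}ᶜ : Set V) → V) ⁻¹' N, (openGraph ω').Reachable ⟨y, mem_compl_singleton_iff.2 hyb⟩ n},
          F (openCluster ω' ⟨z, mem_compl_singleton_iff.2 hzb⟩) ∂(prodBernoulli (w ∘ Sym2.map (Subtype.val : ({b}ᶜ : Set V) → V))) ≤
        ∫ ω' in {ω' : BondConfig ({b}ᶜ : Set V) | ∃ n ∈ (Subtype.val : ({b}ᶜ : Set V) → V) ⁻¹' N,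
            (openGraph ω').Reachable ⟨x, mem_compl_singleton_iff.2 hxb⟩ n} ∪
          {ω' | ∃ n ∈ (Subtype.val : ({b}ᶜ : Set V) → V) ⁻¹' N, (openGraph ω').Reachable ⟨y, mem_compl_singleton_iff.2 hyb⟩ n},
          F (⋃ n ∈ (Subtype.val : ({b}ᶜ : Set V) → V) ⁻¹' N, openCluster ω' n)
            ∂(prodBernoulli (w ∘ Sym2.map (Subtype.val : ({b}ᶜ : Set V) → V))))
    (hzx : (prodBernoulli w).real (openConn z b) ≤ (prodBernoulli w).real (openConn x b))
    (hzy : (prodBernoulli w).real (openConn z b) ≤ (prodBernoulli w).real (openConn y b)) :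
    (prodBernoulli w).real (openConn z b ∩
        ⋃ a ∈ ({x, y, z} : Finset V), {ω : BondConfig V | ∃ n ∈ N, (openGraph ω).Reachable n a}) ≤
      (prodBernoulli w).real ({ω : BondConfig V | ∃ n ∈ N, (openGraph ω).Reachable n b} ∩
        ⋃ a ∈ ({x, y, z} : Finset V), {ω : BondConfig V | ∃ n ∈ N, (openGraph ω).Reachable n a}) := by
  classical
  set μ := prodBernoulli w with hμ
  have hmeas : ∀ T : Set (BondConfig V), MeasurableSet T := fun _ => MeasurableSet.of_discrete
  set Ob : Set (BondConfig V) := {ω : BondConfig V | ∃ n ∈ N, (openGraph ω).Reachable n b} with hOb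
  -- (1) reduction to the peeled form
  refine set_q7_of_psi w N b z ({x, y, z} : Finset V) ?_
  set Jx : Set (BondConfig V) := {ω : BondConfig V | ∃ n ∈ N, ω ∈ openConnIn ({b}ᶜ : Set V) n x} with hJx
  set Jy : Set (BondConfig V) := {ω : BondConfig V | ∃ n ∈ N, ω ∈ openConnIn ({b}ᶜ : Set V) n y} with hJy
  set Jz : Set (BondConfig V) := {ω : BondConfig V | ∃ n ∈ N, ω ∈ openConnIn ({b}ᶜ : Set V) n z} with hJz
  have hJ : ∀ X : Set (BondConfig V),
      X ∩ (⋃ a ∈ ({x, y, z} : Finset V), {ω : BondConfig V | ∃ n ∈ N, ω ∈ openConnIn ({b}ᶜ : Set V) n a}) =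
      X ∩ ((Jx ∪ Jy) ∪ Jz) := by
    intro X; congr 1; ext ω
    simp only [hJx, hJy, hJz, Finset.mem_insert, Finset.mem_singleton, mem_iUnion, mem_union, mem_setOf_eq,
      exists_prop]
    constructor
    · rintro ⟨a, ha, n, hn, h⟩
      rcases ha with rfl | rfl | rfl
      · exact Or.inl (Or.inl ⟨n, hn, h⟩)
      · exact Or.inl (Or.inr ⟨n, hn, h⟩)
      · exact Or.inr ⟨n, hn, h⟩
    · rintro ((⟨n, hn, h⟩ | ⟨n, hn, h⟩) | ⟨n, hn, h⟩)
      · exact ⟨x, Or.inl rfl, n, hn, h⟩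
      · exact ⟨y, Or.inr (Or.inl rfl), n, hn, h⟩
      · exact ⟨z, Or.inr (Or.inr rfl), n, hn, h⟩
  rw [hJ, hJ]
  -- (2) the `z`-part of the peeled event only helps
  have msplit : ∀ X : Set (BondConfig V), μ.real (X ∩ ((Jx ∪ Jy) ∪ Jz)) =
      μ.real (X ∩ (Jx ∪ Jy)) + μ.real (X ∩ Jz ∩ (Jx ∪ Jy)ᶜ) := by
    intro X
    have hdj : Disjoint (X ∩ (Jx ∪ Jy)) (X ∩ Jz ∩ (Jx ∪ Jy)ᶜ) := by
      rw [Set.disjoint_left]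
      rintro ω ⟨-, h⟩ ⟨-, hn⟩
      exact hn h
    rw [← measureReal_union hdj (hmeas _)]
    congr 1
    ext ω
    simp only [mem_inter_iff, mem_union, mem_compl_iff]
    tauto
  have hz_le : μ.real (openConn z b ∩ Jz ∩ (Jx ∪ Jy)ᶜ) ≤ μ.real (Ob ∩ Jz ∩ (Jx ∪ Jy)ᶜ) := by
    refine measureReal_mono fun ω hω => ?_
    obtain ⟨⟨hzb', hJω⟩, hn⟩ := hω
    obtain ⟨n, hnN, hnz⟩ := hJω
    exact ⟨⟨⟨n, hnN, (reachable_of_openConnIn hnz).trans hzb'⟩, n, hnN, hnz⟩, hn⟩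
  rw [msplit, msplit]
  suffices key : μ.real (openConn z b ∩ (Jx ∪ Jy)) ≤ μ.real (Ob ∩ (Jx ∪ Jy)) by linarith
  -- (3) pass to `G ∖ b`
  set S : Set V := {b}ᶜ with hS
  set r := restrictConfig (Subtype.val : S → V) with hr
  set w' : Sym2 S → unitInterval := w ∘ Sym2.map (Subtype.val : S → V) with hw'
  set μ' := prodBernoulli w' with hμ'
  set x' : S := ⟨x, mem_compl_singleton_iff.2 hxb⟩ with hx'
  set y' : S := ⟨y, mem_compl_singleton_iff.2 hyb⟩ with hy'
  set z' : S := ⟨z, mem_compl_singleton_iff.2 hzb⟩ with hz'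
  set N' : Set S := (Subtype.val : S → V) ⁻¹' N with hN'
  set E : Set (BondConfig S) := {ω' : BondConfig S | ∃ n ∈ N', (openGraph ω').Reachable x' n} ∪
    {ω' | ∃ n ∈ N', (openGraph ω').Reachable y' n} with hE
  have hnb : ∀ n ∈ N, n ≠ b := fun n hn h => hbN (h ▸ hn)
  have hJpre : ∀ (v : V) (hvb : v ≠ b),
      {ω : BondConfig V | ∃ n ∈ N, ω ∈ openConnIn ({b}ᶜ : Set V) n v} =
        r ⁻¹' {ω' : BondConfig S | ∃ n ∈ N', (openGraph ω').Reachable ⟨v, mem_compl_singleton_iff.2 hvb⟩ n} := by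
    intro v hvb; ext ω
    simp only [mem_setOf_eq, mem_preimage, hN']
    constructor
    · rintro ⟨n, hn, h⟩
      refine ⟨⟨n, mem_compl_singleton_iff.2 (hnb n hn)⟩, hn, ?_⟩
      rw [reachable_restrictConfig_val_iff]
      rw [openConnIn_comm]; exact h
    · rintro ⟨n', hn', h⟩
      refine ⟨n', hn', ?_⟩
      rw [reachable_restrictConfig_val_iff] at h
      rw [openConnIn_comm]; exact h
  have hJE : Jx ∪ Jy = r ⁻¹' E := by
    rw [hE, preimage_union, hJx, hJy, hJpre x hxb, hJpre y hyb]
  -- the green function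
  set F : Set S → ℝ := fun T => μ.real {ω₁ : BondConfig V | ∃ s ∈ Subtype.val '' T, s ≠ b ∧ s(b, s) ∈ ω₁} with hF
  have hFmono : ∀ T T' : Set S, T ⊆ T' → F T ≤ F T' := by
    intro T T' hTT'
    refine measureReal_mono fun ω₁ hω₁ => ?_
    obtain ⟨s, hs, hsb, hso⟩ := hω₁
    exact ⟨s, image_mono hTT' hs, hsb, hso⟩
  have hbridge : ∀ (v : V) (hvb : v ≠ b) (E₁ : Set (BondConfig S)),
      μ.real (openConn v b ∩ r ⁻¹' E₁) = ∫ ω' in E₁, F (openCluster ω' ⟨v, mem_compl_singleton_iff.2 hvb⟩) ∂μ' := by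
    intro v hvb E₁
    rw [inter_comm, hr, real_inter_openConn_eq_integral_green w b v hvb E₁, ← integral_indicator (hmeas _),
      hμ', hw', ← integral_indicator (MeasurableSet.of_discrete), ← integral_comp_restrictConfig_val]
    refine integral_congr_ae (Filter.Eventually.of_forall fun ω => ?_)
    change (restrictConfig Subtype.val ⁻¹' E₁).indicator _ ω = E₁.indicator _ (restrictConfig Subtype.val ω)
    have hfun : (fun ω : BondConfig V => μ.real {ω₁ : BondConfig V | ∃ s ∈ {y | ω ∈ openConnIn ({b}ᶜ : Set V) v y},
        s ≠ b ∧ s(b, s) ∈ ω₁}) =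
        (fun ω' => F (openCluster ω' ⟨v, mem_compl_singleton_iff.2 hvb⟩)) ∘ restrictConfig (Subtype.val : S → V) := by
      funext ω
      simp only [Function.comp_apply, hF]
      rw [setOf_openConnIn_eq_image b ω ⟨v, mem_compl_singleton_iff.2 hvb⟩]
    rw [hfun]
    exact indicator_comp_right _
  -- the set bridge for the observer side
  have hsetcl : ∀ ω : BondConfig V, {y | ∃ n ∈ N, ω ∈ openConnIn ({b}ᶜ : Set V) n y} =
      Subtype.val '' ⋃ n ∈ N', openCluster (restrictConfig (Subtype.val : S → V) ω) n := by
    intro ω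
    rw [image_iUnion₂]
    ext v
    simp only [mem_setOf_eq, mem_iUnion, hN', mem_preimage, exists_prop]
    constructor
    · rintro ⟨n, hn, h⟩
      refine ⟨⟨n, mem_compl_singleton_iff.2 (hnb n hn)⟩, hn, ?_⟩
      rw [← setOf_openConnIn_eq_image b ω ⟨n, _⟩]
      exact h
    · rintro ⟨n', hn', h⟩
      refine ⟨n', hn', ?_⟩
      rw [← setOf_openConnIn_eq_image b ω n'] at h
      exact h
  have hbridgeN : ∀ (E₁ : Set (BondConfig S)),
      μ.real (Ob ∩ r ⁻¹' E₁) = ∫ ω' in E₁, F (⋃ n ∈ N', openCluster ω' n) ∂μ' := by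
    intro E₁
    rw [inter_comm, hr, hOb, real_inter_setReach_eq_integral_green w b N hbN E₁, ← integral_indicator (hmeas _),
      hμ', hw', ← integral_indicator (MeasurableSet.of_discrete), ← integral_comp_restrictConfig_val]
    refine integral_congr_ae (Filter.Eventually.of_forall fun ω => ?_)
    change (restrictConfig Subtype.val ⁻¹' E₁).indicator _ ω = E₁.indicator _ (restrictConfig Subtype.val ω)
    have hfun : (fun ω : BondConfig V => μ.real {ω₁ : BondConfig V | ∃ s ∈ {y | ∃ n ∈ N, ω ∈ openConnIn ({b}ᶜ : Set V) n y},
        s ≠ b ∧ s(b, s) ∈ ω₁}) =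
        (fun ω' => F (⋃ n ∈ N', openCluster ω' n)) ∘ restrictConfig (Subtype.val : S → V) := by
      funext ω
      simp only [Function.comp_apply, hF]
      rw [hsetcl ω]
    rw [hfun]
    exact indicator_comp_right _
  -- the reliability hypotheses through the bridge (`E₁ = univ`)
  have htau : ∀ (v : V) (hvb : v ≠ b), μ.real (openConn v b) =
      ∫ ω', F (openCluster ω' ⟨v, mem_compl_singleton_iff.2 hvb⟩) ∂μ' := by
    intro v hvb
    rw [← setIntegral_univ, ← hbridge v hvb univ, preimage_univ, inter_univ]
  have hx'' : ∫ ω', F (openCluster ω' z') ∂μ' ≤ ∫ ω', F (openCluster ω' x') ∂μ' := by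
    rw [← htau z hzb, ← htau x hxb]; exact hzx
  have hy'' : ∫ ω', F (openCluster ω' z') ∂μ' ≤ ∫ ω', F (openCluster ω' y') ∂μ' := by
    rw [← htau z hzb, ← htau y hyb]; exact hzy
  rw [hJE, hbridge z hzb E, hbridgeN E]
  exact hG F hFmono hx'' hy''


/-- **Kozma–Nitzan Question 9 at `|A| = 3` (set-observer pre-FKG inequality `(41)_N`) modulo the set-observer marker
dominance lemma.**  With `S = {b}ᶜ`, the induced weights `w' = w ∘ Sym2.map val` on `S`, `x', y', z'` the relays and
`N' = val⁻¹ N` the observer set read in `S`: if `μ'(x'↮y', x'↮z') > 0`, `μ'(y'↮x', y'↮z') > 0` and the set-observer marker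
dominance lemma holds on `G ∖ b` on the `x'`- and on the `y'`-side for every monotone `G` (the hypotheses `hMDLx`, `hMDLy` of
`Q7Psi.gpsi_three_set_of_setMDL`, verbatim on `S`), then for `z` the relay least connected to `b` IN `G`
(`μ(z↔b) ≤ μ(x↔b), μ(y↔b)`):  `μ({z↔b} ∩ {N↔A}) ≤ μ({N↔b} ∩ {N↔A})`, `A = {x,y,z}`.
This is `setPreFKG_three_of_gpsiSet ∘ gpsi_three_set_of_setMDL`; for `N = {o}` the hypothesis is the tree theorem COV(τ) and the
conclusion is `Q7Psi.q7_three`.  [cite: KozmaNitzan2024, Question 9 (p. 36), §5.1 (pp. 31–32)] -/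
theorem setPreFKG_three_of_setMDL (w : Sym2 V → unitInterval) (N : Set V) (b x y z : V) (hbN : b ∉ N)
    (hxb : x ≠ b) (hyb : y ≠ b) (hzb : z ≠ b) (hxy : x ≠ y) (hxz : x ≠ z) (hyz : y ≠ z)
    (hE1 : 0 < (prodBernoulli (w ∘ Sym2.map (Subtype.val : ({b}ᶜ : Set V) → V))).real
      ({ω' : BondConfig ({b}ᶜ : Set V) | ¬ (openGraph ω').Reachable ⟨x, mem_compl_singleton_iff.2 hxb⟩ ⟨y, mem_compl_singleton_iff.2 hyb⟩} ∩
        {ω' | ¬ (openGraph ω').Reachable ⟨x, mem_compl_singleton_iff.2 hxb⟩ ⟨z, mem_compl_singleton_iff.2 hzb⟩}))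
    (hE2 : 0 < (prodBernoulli (w ∘ Sym2.map (Subtype.val : ({b}ᶜ : Set V) → V))).real
      ({ω' : BondConfig ({b}ᶜ : Set V) | ¬ (openGraph ω').Reachable ⟨y, mem_compl_singleton_iff.2 hyb⟩ ⟨x, mem_compl_singleton_iff.2 hxb⟩} ∩
        {ω' | ¬ (openGraph ω').Reachable ⟨y, mem_compl_singleton_iff.2 hyb⟩ ⟨z, mem_compl_singleton_iff.2 hzb⟩}))
    (hMDLx : let S : Set V := {b}ᶜ; let w' : Sym2 S → unitInterval := w ∘ Sym2.map (Subtype.val : S → V);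
      let x' : S := ⟨x, mem_compl_singleton_iff.2 hxb⟩; let y' : S := ⟨y, mem_compl_singleton_iff.2 hyb⟩;
      let z' : S := ⟨z, mem_compl_singleton_iff.2 hzb⟩; let N' : Set S := (Subtype.val : S → V) ⁻¹' N;
      ∀ G : Set S → ℝ, (∀ T T' : Set S, T ⊆ T' → G T ≤ G T') →
      (prodBernoulli w').real ({ω : BondConfig S | ∃ n ∈ N', (openGraph ω).Reachable y' n} ∩
            ({ω | ∀ n ∈ N', ¬ (openGraph ω).Reachable x' n} ∩ {ω | ∀ n ∈ N', ¬ (openGraph ω).Reachable z' n})) *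
        ((prodBernoulli w').real {ω : BondConfig S | ¬ (openGraph ω).Reachable x' z'} *
            (∫ ω in openConn x' y' ∩ {ω | ¬ (openGraph ω).Reachable x' z'}, G (openCluster ω x') ∂(prodBernoulli w')) -
          (prodBernoulli w').real (openConn x' y' ∩ {ω | ¬ (openGraph ω).Reachable x' z'}) *
            ∫ ω in {ω : BondConfig S | ¬ (openGraph ω).Reachable x' z'}, G (openCluster ω x') ∂(prodBernoulli w')) ≤
      (prodBernoulli w').real ({ω : BondConfig S | ¬ (openGraph ω).Reachable y' x'} ∩
          {ω | ¬ (openGraph ω).Reachable y' z'}) *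
        ((prodBernoulli w').real {ω : BondConfig S | ¬ (openGraph ω).Reachable x' z'} *
            (∫ ω in {ω : BondConfig S | ∃ n ∈ N', (openGraph ω).Reachable x' n} ∩
              {ω | ∀ n ∈ N', ¬ (openGraph ω).Reachable z' n}, G (openCluster ω x') ∂(prodBernoulli w')) -
          (prodBernoulli w').real ({ω : BondConfig S | ∃ n ∈ N', (openGraph ω).Reachable x' n} ∩
              {ω | ∀ n ∈ N', ¬ (openGraph ω).Reachable z' n}) *
            ∫ ω in {ω : BondConfig S | ¬ (openGraph ω).Reachable x' z'}, G (openCluster ω x') ∂(prodBernoulli w')))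
    (hMDLy : let S : Set V := {b}ᶜ; let w' : Sym2 S → unitInterval := w ∘ Sym2.map (Subtype.val : S → V);
      let x' : S := ⟨x, mem_compl_singleton_iff.2 hxb⟩; let y' : S := ⟨y, mem_compl_singleton_iff.2 hyb⟩;
      let z' : S := ⟨z, mem_compl_singleton_iff.2 hzb⟩; let N' : Set S := (Subtype.val : S → V) ⁻¹' N;
      ∀ G : Set S → ℝ, (∀ T T' : Set S, T ⊆ T' → G T ≤ G T') →
      (prodBernoulli w').real ({ω : BondConfig S | ∃ n ∈ N', (openGraph ω).Reachable x' n} ∩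
            ({ω | ∀ n ∈ N', ¬ (openGraph ω).Reachable y' n} ∩ {ω | ∀ n ∈ N', ¬ (openGraph ω).Reachable z' n})) *
        ((prodBernoulli w').real {ω : BondConfig S | ¬ (openGraph ω).Reachable y' z'} *
            (∫ ω in openConn y' x' ∩ {ω | ¬ (openGraph ω).Reachable y' z'}, G (openCluster ω y') ∂(prodBernoulli w')) -
          (prodBernoulli w').real (openConn y' x' ∩ {ω | ¬ (openGraph ω).Reachable y' z'}) *
            ∫ ω in {ω : BondConfig S | ¬ (openGraph ω).Reachable y' z'}, G (openCluster ω y') ∂(prodBernoulli w')) ≤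
      (prodBernoulli w').real ({ω : BondConfig S | ¬ (openGraph ω).Reachable x' y'} ∩
          {ω | ¬ (openGraph ω).Reachable x' z'}) *
        ((prodBernoulli w').real {ω : BondConfig S | ¬ (openGraph ω).Reachable y' z'} *
            (∫ ω in {ω : BondConfig S | ∃ n ∈ N', (openGraph ω).Reachable y' n} ∩
              {ω | ∀ n ∈ N', ¬ (openGraph ω).Reachable z' n}, G (openCluster ω y') ∂(prodBernoulli w')) -
          (prodBernoulli w').real ({ω : BondConfig S | ∃ n ∈ N', (openGraph ω).Reachable y' n} ∩
              {ω | ∀ n ∈ N', ¬ (openGraph ω).Reachable z' n}) *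
            ∫ ω in {ω : BondConfig S | ¬ (openGraph ω).Reachable y' z'}, G (openCluster ω y') ∂(prodBernoulli w')))
    (hzx : (prodBernoulli w).real (openConn z b) ≤ (prodBernoulli w).real (openConn x b))
    (hzy : (prodBernoulli w).real (openConn z b) ≤ (prodBernoulli w).real (openConn y b)) :
    (prodBernoulli w).real (openConn z b ∩
        ⋃ a ∈ ({x, y, z} : Finset V), {ω : BondConfig V | ∃ n ∈ N, (openGraph ω).Reachable n a}) ≤
      (prodBernoulli w).real ({ω : BondConfig V | ∃ n ∈ N, (openGraph ω).Reachable n b} ∩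
        ⋃ a ∈ ({x, y, z} : Finset V), {ω : BondConfig V | ∃ n ∈ N, (openGraph ω).Reachable n a}) := by
  haveI : Fintype ({b}ᶜ : Set V) := Fintype.ofFinite _
  have hxy' : (⟨x, mem_compl_singleton_iff.2 hxb⟩ : ({b}ᶜ : Set V)) ≠ ⟨y, mem_compl_singleton_iff.2 hyb⟩ :=
    fun h => hxy (congrArg Subtype.val h)
  have hxz' : (⟨x, mem_compl_singleton_iff.2 hxb⟩ : ({b}ᶜ : Set V)) ≠ ⟨z, mem_compl_singleton_iff.2 hzb⟩ :=
    fun h => hxz (congrArg Subtype.val h)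
  have hyz' : (⟨y, mem_compl_singleton_iff.2 hyb⟩ : ({b}ᶜ : Set V)) ≠ ⟨z, mem_compl_singleton_iff.2 hzb⟩ :=
    fun h => hyz (congrArg Subtype.val h)
  refine setPreFKG_three_of_gpsiSet w N b x y z hbN hxb hyb hzb (fun F hF hx hy => ?_) hzx hzy
  exact gpsi_three_set_of_setMDL (w ∘ Sym2.map (Subtype.val : ({b}ᶜ : Set V) → V)) _ _ _ _ hxy' hxz' hyz' hE1 hE2
    hMDLx hMDLy F hF hx hy

end Q7Psi

end

end Summit.CriticalPhenomena.PercolationContinuityZ3.Theorems
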